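import Summits.ValiantsHypothesis.ValiantsHypothesis.Theorems.NNDivisionHard.Negative.AsymmetricWindowInformative

/-!
# AsymmetricWindow39 — PART 3a: §4 PROPOSITION H — the abstract hash-rectangle cap and the located disjointness-witness cap

Theorems-side port (val-port-1 g4; critic of record val-idea-crit-9 g4; source of record val-idea-39 g6's
`Cruxes/NNDivisionHard/AsymmetricWindow39.lean` REV 3 @e78aa2176e1c, sha16 7e4b5ff93693dde0, §4 `HashCap`): declaration texts VERBATIM, namespace
`Summit.ValiantsHypothesis.Theorems.NNDivisionHardNegative.AsymmetricWindow` (parts 1–2 = `…AsymmetricWindowSlice` / `…AsymmetricWindowInformative`); §4 is split at the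
`hash_rectangle_cap` / `hash_carrier_cap` seam for the 400-line norm.  S2 INSTRUMENTS (PROPOSITION H / H′: hash-rectangle caps on located
witnesses), helper lane; nothing closes; `NNDivisionHard` (stmt-21181) OPEN; VP ≠ VNP NOT proved.
-/

namespace Summit.ValiantsHypothesis.Theorems.NNDivisionHardNegative.AsymmetricWindow

open Finset
open Literature.Barriers.PneNP (disjPairs mem_disjPairs IsKWValid disjPairs_filter_fst_eq)
open Literature.Combinatorics.Optimization (HasNonnegFactorization hasNonnegFactorization_of_fintype)
open Summit.ValiantsHypothesis.Theorems.NNDivisionHardNegative.BlindCubeIdentity (ind ind_nonneg ind_le_one)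
open Summit.ValiantsHypothesis.Theorems.NNDivisionHardNegative.WeakReliefBlind (inv invInd invInd_nonneg)

/-! ## §4  PROPOSITION H in kernel: hash rectangles cap every located disjointness-pattern witness (no `n`-dependence)

The hyperplane (rectangle-LP) bound of a weight `W` is `B_W = ⟨W,M⟩ / max{⟨W, u vᵀ⟩ : u, v ≥ 0, u vᵀ ≤ M}`; every nonnegative
factorisation has `≥ B_W` slots.  A CAP on a CLASS of witnesses is a feasible rectangle that every `W` of the class rewards.
CLASS D (located disjointness-pattern witnesses, the genus of Kaibel–Weltge / Razborov / BFPS Thm 5, hence of T2 and T3, however glued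
across clusters): `W` vanishes off the NEAR entries (`near a c`), is `≥ 0` on near entries of intersection LEVEL `≠ 1` and (for the ratio)
`≤ 0` on near entries of level `1`.  THE CAP (`hash_rectangle_cap`, abstract; `located_disjointness_witness_cap`, the pencil): for a hash family
`H : Ξ → Row → Prop` with `Pr[H a] ≥ 1/q` and `Pr[H a ∧ H a′] ≤ 1/q²` (`a ≠ a′`) and `q ≥ 2N₁`, `N₁` = max number of near level-1 rows of a
column, SOME hash rectangle `u = s·1_{H ξ}`, `v = 1_{no near level-1 row of c is hit}` is feasible (`u vᵀ ≤ M`) and earns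
`⟨W, u vᵀ⟩ ≥ (s/2q)·Σ⁺`, `Σ⁺ = Σ_{near, level ≠ 1} W`, while `⟨W, M⟩ ≤ M⁺·Σ⁺`; so `B_W ≤ 2q·M⁺/s` — for the pencil on the slice `k` with
budget `w ≥ 1/λ − 1`: `s = 1`, `q = 2((w+1)^{√w})²` (K3), `M⁺ ≤ (√w−1)² + λw` on the canonical clusters `b ∩ P_k(π) = ∅` (`≤ (k−1)² + λw ≤ n²`
for arbitrary columns): `B_W = 2^{O(√w log w)}` (times at most `n²`), no `n^{f(λ)}`.
The capping rectangles are the hash classes `{a : Σ_{x∈a} ω(x) = c₀ in ℤ_q}` — an ASYMMETRIC row family (neither juntas nor symmetric).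
PROPOSITION H′ (`hash_carrier_cap` = hash × arbitrary feasible carrier with an exclusion relation; `located_witness_cap` = the pencil):
the sign condition is unnecessary — every `W` vanishing off the near entries of the slice is capped, `s·⟨W,M_λ⟩ ≤ 4q(n+1)²·⟨W,u vᵀ⟩`,
by the better of the hashed unit carrier (columns with a hit level-1 or negative near row excluded) and a hashed inversion carrier
`λ[l∈a][l′∉a] ⊗ [π(l′)<π(l)] ≤ λ·inv ≤ M_λ` (columns with a hit negative near row excluded; `n²` carriers, pigeonhole). -/

section HashCap


/-- **Abstract hash-rectangle cap.**  Rows, columns, a hash index type `Ξ`; `near`/`lvl` = the located structure; `M ≥ 0` with `M ≥ s` on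
every entry that is not a near level-1 entry; a hash family hitting each row with probability `≥ 1/q` and each pair of distinct rows with
probability `≤ 1/q²`; at most `N₁ ≤ q/2` near level-1 rows per column; `W = 0` off the near entries and `W ≥ 0` on near entries of level `≠ 1`.
Then some hash rectangle `u vᵀ ≤ M` has `s·Σ⁺ ≤ 2q·⟨W, u vᵀ⟩`. -/
theorem hash_rectangle_cap {Row Col Ξ : Type*} [Fintype Row] [DecidableEq Row] [Fintype Col] [Fintype Ξ] [Nonempty Ξ]
    (M W : Row → Col → ℝ) (near : Row → Col → Prop) [∀ a c, Decidable (near a c)] (lvl : Row → Col → ℕ)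
    (H : Ξ → Row → Prop) [∀ ξ a, Decidable (H ξ a)] {q N₁ : ℕ} (hq : 0 < q) (hqN : 2 * N₁ ≤ q)
    {s : ℝ} (hs : 0 ≤ s) (hM0 : ∀ a c, 0 ≤ M a c)
    (hM : ∀ a c, (near a c → lvl a c ≠ 1) → s ≤ M a c)
    (hH1 : ∀ a, (Fintype.card Ξ : ℝ) ≤ q * ((Finset.univ.filter (fun ξ => H ξ a)).card : ℝ))
    (hH2 : ∀ a a', a ≠ a' →
      (q : ℝ) ^ 2 * ((Finset.univ.filter (fun ξ => H ξ a ∧ H ξ a')).card : ℝ) ≤ Fintype.card Ξ)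
    (hN : ∀ c, (Finset.univ.filter (fun a => near a c ∧ lvl a c = 1)).card ≤ N₁)
    (hWfar : ∀ a c, ¬ near a c → W a c = 0)
    (hWpos : ∀ a c, near a c → lvl a c ≠ 1 → 0 ≤ W a c) :
    ∃ (u : Row → ℝ) (v : Col → ℝ), (∀ a, 0 ≤ u a) ∧ (∀ c, 0 ≤ v c) ∧ (∀ a c, u a * v c ≤ M a c) ∧
      s * (∑ a, ∑ c, if near a c ∧ lvl a c ≠ 1 then W a c else 0) ≤
        2 * q * ∑ a, ∑ c, W a c * (u a * v c) := by
  classical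
  -- the hash rectangle of `ξ`
  let B : Ξ → Col → Prop := fun ξ c => ∀ a', near a' c → lvl a' c = 1 → ¬ H ξ a'
  let u : Ξ → Row → ℝ := fun ξ a => if H ξ a then s else 0
  let v : Ξ → Col → ℝ := fun ξ c => if B ξ c then 1 else 0
  have hu0 : ∀ ξ a, 0 ≤ u ξ a := fun ξ a => by simp only [u]; split_ifs <;> simp [hs]
  have hv0 : ∀ ξ c, 0 ≤ v ξ c := fun ξ c => by simp only [v]; split_ifs <;> simp
  have huv : ∀ ξ a c, u ξ a * v ξ c = if H ξ a ∧ B ξ c then s else 0 := by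
    intro ξ a c; simp only [u, v]; split_ifs <;> simp_all
  -- feasibility
  have hfeas : ∀ ξ a c, u ξ a * v ξ c ≤ M a c := by
    intro ξ a c
    rw [huv]
    split_ifs with h
    · refine hM a c fun hn h1 => ?_
      exact h.2 a hn h1 h.1
    · exact hM0 a c
  -- the count K(a,c) = #{ξ : H ξ a ∧ B ξ c} for a near entry of level ≠ 1
  have hK : ∀ a c, near a c → lvl a c ≠ 1 →
      (Fintype.card Ξ : ℝ) ≤ 2 * q * ((Finset.univ.filter (fun ξ => H ξ a ∧ B ξ c)).card : ℝ) := by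
    intro a c hn hl
    set N1c := Finset.univ.filter (fun a' => near a' c ∧ lvl a' c = 1) with hN1c
    have hcover : Finset.univ.filter (fun ξ => H ξ a) ⊆
        Finset.univ.filter (fun ξ => H ξ a ∧ B ξ c) ∪
          N1c.biUnion (fun a' => Finset.univ.filter (fun ξ => H ξ a ∧ H ξ a')) := by
      intro ξ hξ
      rw [mem_filter] at hξ
      rw [Finset.mem_union, mem_filter, Finset.mem_biUnion]
      by_cases hB : B ξ c
      · exact Or.inl ⟨mem_univ _, hξ.2, hB⟩
      · right
        simp only [B, not_forall, not_not, exists_prop] at hB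
        obtain ⟨a', ha'n, ha'l, ha'H⟩ := hB
        exact ⟨a', mem_filter.2 ⟨mem_univ _, ha'n, ha'l⟩, mem_filter.2 ⟨mem_univ _, hξ.2, ha'H⟩⟩
    have h1 : ((Finset.univ.filter (fun ξ => H ξ a)).card : ℝ) ≤
        ((Finset.univ.filter (fun ξ => H ξ a ∧ B ξ c)).card : ℝ) +
          ∑ a' ∈ N1c, ((Finset.univ.filter (fun ξ => H ξ a ∧ H ξ a')).card : ℝ) := by
      have := (card_le_card hcover).trans
        ((Finset.card_union_le _ _).trans (Nat.add_le_add_left Finset.card_biUnion_le _))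
      exact_mod_cast this
    have h2 : ∀ a' ∈ N1c, (q : ℝ) ^ 2 * ((Finset.univ.filter (fun ξ => H ξ a ∧ H ξ a')).card : ℝ) ≤
        Fintype.card Ξ := by
      intro a' ha'
      refine hH2 a a' fun h => hl ?_
      rw [h]; exact ((mem_filter.1 ha').2).2
    have h3 : (q : ℝ) ^ 2 * ∑ a' ∈ N1c, ((Finset.univ.filter (fun ξ => H ξ a ∧ H ξ a')).card : ℝ) ≤
        N1c.card * Fintype.card Ξ := by
      rw [Finset.mul_sum]
      have := Finset.sum_le_sum h2
      simpa using this
    have hqr : (0 : ℝ) < q := by exact_mod_cast hq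
    have hNc : (N1c.card : ℝ) * 2 ≤ q := by
      have := (hN c); rw [← hN1c] at this
      have : (N1c.card : ℝ) ≤ N₁ := by exact_mod_cast this
      have hqN' : (2 * N₁ : ℝ) ≤ q := by exact_mod_cast hqN
      linarith
    have hX := hH1 a
    -- combine: card Ξ ≤ q·#H = q·(K + S) and q²·S ≤ |N1c|·card Ξ ≤ (q/2)·card Ξ
    have hcardnn : (0 : ℝ) ≤ Fintype.card Ξ := Nat.cast_nonneg _
    nlinarith [h1, h3, hNc, hX, hqr, hcardnn,
      mul_nonneg hqr.le (Nat.cast_nonneg (Finset.univ.filter (fun ξ => H ξ a ∧ B ξ c)).card)]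
  -- the averaged reward, entry by entry
  have hentry : ∀ a c, (Fintype.card Ξ : ℝ) * (s * (if near a c ∧ lvl a c ≠ 1 then W a c else 0)) ≤
      2 * q * ∑ ξ, W a c * (u ξ a * v ξ c) := by
    intro a c
    have hcount : ∑ ξ, W a c * (u ξ a * v ξ c) =
        W a c * s * ((Finset.univ.filter (fun ξ => H ξ a ∧ B ξ c)).card : ℝ) := by
      simp only [huv]
      rw [← Finset.mul_sum, Finset.sum_ite, Finset.sum_const_zero, add_zero, Finset.sum_const, nsmul_eq_mul]
      ring
    rw [hcount]
    by_cases hn : near a c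
    · by_cases hl : lvl a c ≠ 1
      · rw [if_pos ⟨hn, hl⟩]
        have hKac := hK a c hn hl
        have hW := hWpos a c hn hl
        nlinarith [mul_nonneg hW hs]
      · -- level 1: the rectangle vanishes there
        rw [if_neg (fun h => hl h.2)]
        have hempty : Finset.univ.filter (fun ξ => H ξ a ∧ B ξ c) = ∅ := by
          rw [Finset.filter_eq_empty_iff]
          intro ξ _ h
          exact h.2 a hn (not_not.1 hl) h.1
        rw [hempty]; simp
    · rw [if_neg (fun h => hn h.1), hWfar a c hn]; simp
  have hG : (Fintype.card Ξ : ℝ) * (s * ∑ a, ∑ c, if near a c ∧ lvl a c ≠ 1 then W a c else 0) ≤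
      2 * q * ∑ ξ, ∑ a, ∑ c, W a c * (u ξ a * v ξ c) := by
    have hcomm : ∑ ξ, ∑ a, ∑ c, W a c * (u ξ a * v ξ c) = ∑ a, ∑ c, ∑ ξ, W a c * (u ξ a * v ξ c) := by
      rw [Finset.sum_comm]
      exact Finset.sum_congr rfl fun a _ => Finset.sum_comm
    rw [hcomm, Finset.mul_sum, Finset.mul_sum, Finset.mul_sum]
    refine Finset.sum_le_sum fun a _ => ?_
    rw [Finset.mul_sum, Finset.mul_sum, Finset.mul_sum]
    exact Finset.sum_le_sum fun c _ => hentry a c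
  -- pick a ξ at least as good as the average
  obtain ⟨ξ, _, hξ⟩ := Finset.exists_le_of_sum_le (Finset.univ_nonempty (α := Ξ))
    (f := fun _ : Ξ => s * ∑ a, ∑ c, if near a c ∧ lvl a c ≠ 1 then W a c else 0)
    (g := fun ξ => 2 * q * ∑ a, ∑ c, W a c * (u ξ a * v ξ c)) (by
      rw [Finset.sum_const, nsmul_eq_mul, Finset.card_univ, ← Finset.mul_sum]
      exact hG)
  exact ⟨u ξ, v ξ, hu0 ξ, hv0 ξ, hfeas ξ, hξ⟩

/-- The ratio form: if moreover `W ≤ 0` on near level-1 entries and `M ≤ M⁺` on near entries of level `≠ 1`, then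
`⟨W, M⟩ ≤ M⁺·Σ⁺`; with `hash_rectangle_cap` this is `B_W ≤ 2q·M⁺/s`. -/
theorem witness_value_le {Row Col : Type*} [Fintype Row] [Fintype Col]
    (M W : Row → Col → ℝ) (near : Row → Col → Prop) [∀ a c, Decidable (near a c)] (lvl : Row → Col → ℕ)
    {Mmax : ℝ} (hM0 : ∀ a c, 0 ≤ M a c) (hMmax : ∀ a c, near a c → lvl a c ≠ 1 → M a c ≤ Mmax)
    (hWfar : ∀ a c, ¬ near a c → W a c = 0) (hWneg : ∀ a c, near a c → lvl a c = 1 → W a c ≤ 0)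
    (hWpos : ∀ a c, near a c → lvl a c ≠ 1 → 0 ≤ W a c) :
    ∑ a, ∑ c, W a c * M a c ≤ Mmax * ∑ a, ∑ c, if near a c ∧ lvl a c ≠ 1 then W a c else 0 := by
  rw [Finset.mul_sum]
  refine Finset.sum_le_sum fun a _ => ?_
  rw [Finset.mul_sum]
  refine Finset.sum_le_sum fun c _ => ?_
  by_cases hn : near a c
  · by_cases hl : lvl a c ≠ 1
    · rw [if_pos ⟨hn, hl⟩, mul_comm]
      exact mul_le_mul_of_nonneg_right (hMmax a c hn hl) (hWpos a c hn hl)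
    · rw [if_neg (fun h => hl h.2), mul_zero]
      exact mul_nonpos_of_nonpos_of_nonneg (hWneg a c hn (not_not.1 hl)) (hM0 a c)
  · rw [if_neg (fun h => hn h.1), hWfar a c hn]; simp

/-! ### The linear hash family over `ℤ_q`: `H (ω, c₀) a ⇔ Σ_{x∈a} ω(x) = c₀` -/

variable {n : ℕ}

/-- the linear hash of a row -/
def hashOf {q : ℕ} (ω : Fin n → ZMod q) (a : Finset (Fin n)) : ZMod q := ∑ x ∈ a, ω x

/-- `hashOf` is additive in the weight vector. -/
theorem hashOf_add {q : ℕ} (ω ω' : Fin n → ZMod q) (a : Finset (Fin n)) :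
    hashOf (ω + ω') a = hashOf ω a + hashOf ω' a := by
  simp [hashOf, Finset.sum_add_distrib]

/-- `hashOf` of a weight supported at one point. -/
theorem hashOf_smul_single {q : ℕ} (x₀ : Fin n) (cst : ZMod q) (a : Finset (Fin n)) :
    hashOf (cst • (Pi.single x₀ (1 : ZMod q) : Fin n → ZMod q)) a = if x₀ ∈ a then cst else 0 := by
  simp only [hashOf, Pi.smul_apply, smul_eq_mul, Pi.single_apply, mul_ite, mul_one, mul_zero]
  exact Finset.sum_ite_eq' a x₀ (fun _ => cst)

/-- two indicator constraints on one free value: `Σ_{c₀} [x = c₀ ∧ y = c₀] = [x = y]` -/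
theorem sum_ite_and_eq {q : ℕ} [NeZero q] (x y : ZMod q) :
    ∑ c₀ : ZMod q, (if x = c₀ ∧ y = c₀ then (1 : ℕ) else 0) = if x = y then 1 else 0 := by
  by_cases hxy : x = y
  · subst hxy
    rw [if_pos rfl]
    have : ∀ c₀ : ZMod q, (x = c₀ ∧ x = c₀) = (x = c₀) := fun c₀ => propext ⟨fun h => h.1, fun h => ⟨h, h⟩⟩
    simp_rw [this]
    rw [Finset.sum_ite_eq]; simp
  · rw [if_neg hxy]
    refine Finset.sum_eq_zero fun c₀ _ => ?_
    rw [if_neg]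
    rintro ⟨rfl, rfl⟩; exact hxy rfl

/-- **One hash constraint:** `#{(ω, c₀) : Σ_{x∈a} ω(x) = c₀} · q = q^{n+1}` (for each `ω` exactly one `c₀`). -/
theorem hash_count_one {q : ℕ} [NeZero q] (a : Finset (Fin n)) :
    q * (Finset.univ.filter (fun ξ : (Fin n → ZMod q) × ZMod q => hashOf ξ.1 a = ξ.2)).card =
      Fintype.card ((Fin n → ZMod q) × ZMod q) := by
  rw [Finset.card_filter, Fintype.sum_prod_type]
  simp only [Finset.sum_ite_eq, Finset.mem_univ, if_true, Finset.sum_const, Finset.card_univ, smul_eq_mul, mul_one,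
    Fintype.card_prod, ZMod.card]
  ring

/-- all fibres of the difference form `φ(ω) = Σ_{a} ω − Σ_{a′} ω` have the same size when `a ≠ a′` (translate along a
coordinate in the symmetric difference, where `φ` has coefficient `±1`). -/
theorem card_fibre_hashDiff_eq {q : ℕ} [NeZero q] {a a' : Finset (Fin n)} (haa : a ≠ a') (d : ZMod q) :
    (Finset.univ.filter (fun ω : Fin n → ZMod q => hashOf ω a - hashOf ω a' = d)).card =
      (Finset.univ.filter (fun ω : Fin n → ZMod q => hashOf ω a - hashOf ω a' = 0)).card := by
  -- a coordinate where the form has coefficient ±1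
  have hx : ∃ x₀, (x₀ ∈ a ∧ x₀ ∉ a') ∨ (x₀ ∈ a' ∧ x₀ ∉ a) := by
    by_contra hne
    apply haa
    ext x
    simp only [not_exists, not_or, not_and, not_not] at hne
    exact ⟨fun hx => (hne x).1 hx, fun hx' => (hne x).2 hx'⟩
  obtain ⟨x₀, hx₀⟩ := hx
  let ε : ZMod q := if x₀ ∈ a then 1 else -1
  let e : Fin n → ZMod q := Pi.single x₀ 1
  have hφe : ∀ cst : ZMod q, hashOf (cst • e) a - hashOf (cst • e) a' = cst * ε := by
    intro cst
    rw [hashOf_smul_single, hashOf_smul_single]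
    rcases hx₀ with ⟨h1, h2⟩ | ⟨h1, h2⟩
    · simp [ε, h1, h2]
    · simp [ε, h1, h2]
  have hε2 : ε * ε = 1 := by
    rcases hx₀ with ⟨h1, _⟩ | ⟨_, h2⟩
    · simp [ε, h1]
    · simp [ε, h2]
  -- translation ω ↦ ω - (ε d) • e maps the fibre over d onto the fibre over 0
  symm
  refine Finset.card_bij (fun ω _ => ω + (ε * d) • e) ?_ ?_ ?_
  · intro ω hω
    rw [mem_filter] at hω ⊢
    refine ⟨mem_univ _, ?_⟩
    rw [hashOf_add, hashOf_add, add_sub_add_comm, hω.2, hφe, zero_add, mul_assoc, mul_comm d ε, ← mul_assoc, hε2,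
      one_mul]
  · intro ω₁ _ ω₂ _ h
    exact add_right_cancel h
  · intro ω' hω'
    rw [mem_filter] at hω'
    refine ⟨ω' - (ε * d) • e, ?_, by simp⟩
    rw [mem_filter]
    refine ⟨mem_univ _, ?_⟩
    have h1 : hashOf ω' a - hashOf ω' a' = (hashOf (ω' - (ε * d) • e) a - hashOf (ω' - (ε * d) • e) a') +
        (hashOf ((ε * d) • e) a - hashOf ((ε * d) • e) a') := by
      rw [← add_sub_add_comm, ← hashOf_add, ← hashOf_add, sub_add_cancel]
    rw [hω'.2, hφe, mul_assoc, mul_comm d ε, ← mul_assoc, hε2, one_mul] at h1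
    -- h1 : d = X + d
    have := h1
    linear_combination -this

/-- **Two hash constraints on distinct rows:** `#{(ω,c₀) : hash a = c₀ = hash a′} · q² = q^{n+1}`. -/
theorem hash_count_two {q : ℕ} [NeZero q] {a a' : Finset (Fin n)} (haa : a ≠ a') :
    q ^ 2 * (Finset.univ.filter
        (fun ξ : (Fin n → ZMod q) × ZMod q => hashOf ξ.1 a = ξ.2 ∧ hashOf ξ.1 a' = ξ.2)).card =
      Fintype.card ((Fin n → ZMod q) × ZMod q) := by
  rw [Finset.card_filter, Fintype.sum_prod_type]
  simp only [sum_ite_and_eq]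
  -- Σ_ω [hash a = hash a'] = #fibre over 0 of the difference form
  have hfib : ∑ ω : Fin n → ZMod q, (if hashOf ω a = hashOf ω a' then 1 else 0) =
      (Finset.univ.filter (fun ω : Fin n → ZMod q => hashOf ω a - hashOf ω a' = 0)).card := by
    rw [Finset.card_filter]
    refine Finset.sum_congr rfl fun ω _ => ?_
    simp only [sub_eq_zero]
  rw [hfib]
  -- all q fibres have this size and partition the q^n functions
  have hpart : ∑ d : ZMod q, (Finset.univ.filter (fun ω : Fin n → ZMod q => hashOf ω a - hashOf ω a' = d)).card =
      (Finset.univ : Finset (Fin n → ZMod q)).card :=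
    (Finset.card_eq_sum_card_fiberwise (fun ω _ => Finset.mem_univ (hashOf ω a - hashOf ω a'))).symm
  simp_rw [card_fibre_hashDiff_eq haa] at hpart
  rw [Finset.sum_const, Finset.card_univ, ZMod.card, smul_eq_mul] at hpart
  rw [Fintype.card_prod, ZMod.card, Fintype.card_pi, Finset.prod_const, ZMod.card, Finset.card_univ, Fintype.card_fin]
  rw [Finset.card_univ, Fintype.card_pi, Finset.prod_const, ZMod.card, Finset.card_univ, Fintype.card_fin] at hpart
  rw [sq, mul_assoc, hpart]
  ring


/-! ### The pencil instance: CLASS-D witnesses on the slice `k` are capped independently of `n` -/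

/-- the inversion count is nonnegative. -/
theorem inv_nonneg (a : Finset (Fin n)) (π : Equiv.Perm (Fin n)) : (0 : ℤ) ≤ inv a π := by
  rw [inv_eq_card_invPairs]; exact Nat.cast_nonneg _

/-- `1 ≤ (1 − t)²` for a natural `t ≠ 1`. -/
theorem one_le_sq_one_sub_of_ne_one {t : ℕ} (ht : t ≠ 1) : (1 : ℝ) ≤ (1 - (t : ℝ)) ^ 2 := by
  rcases Nat.lt_or_ge t 1 with h | h
  · have : t = 0 := by omega
    subst this; norm_num
  · have h2 : (2 : ℝ) ≤ t := by exact_mod_cast (show 2 ≤ t by omega)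
    nlinarith

/-- **PROPOSITION H (kernel).**  On the slice `|a| = k ≤ n` of the located pencil `M_λ` (`λ ≥ 0`), with budget `w` (near ⇔ `inv ≤ w`)
and any modulus `q ≥ 2((w+1)^{√w})²`: for EVERY weight `W` on slice-rows × columns vanishing off the near entries and nonnegative on the
near entries of intersection level `≠ 1` (CLASS D; its values on near level-1 entries are arbitrary), some hash rectangle
`u vᵀ ≤ M_λ` (`u = s·1{Σ_{x∈a} ω(x) = c₀}`, `v = 1{no near level-1 row of the column is hit}`, `s = min(1, λ(w+1))`) has
`s·Σ⁺ ≤ 2q·⟨W, u vᵀ⟩`, `Σ⁺ = Σ_{near, level ≠ 1} W`.  With `witness_value_le` (`⟨W,M⟩ ≤ M⁺Σ⁺`, `M⁺` = max entry on `supp W` at level `≠ 1`,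
`≤ (√w−1)² + λw` on the canonical clusters, `≤ n²` always): the hyperplane bound of every CLASS-D witness is `≤ 2q·M⁺/s = 2^{O(√w·log w)}`
(times at most `n²`) for `w ≥ 1/λ − 1` — no `n^{f(λ)}`.  (T2/T3 are CLASS D.) -/
theorem located_disjointness_witness_cap (k w q : ℕ) [NeZero q] (hkn : k ≤ n)
    (hqN : 2 * ((w + 1) ^ Nat.sqrt w) ^ 2 ≤ q) {lam : ℝ} (hlam : 0 ≤ lam)
    (W : {a : Finset (Fin n) // a.card = k} → Finset (Fin n) × Equiv.Perm (Fin n) → ℝ)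
    (hWfar : ∀ a c, ¬ (inv a.1 c.2 ≤ w) → W a c = 0)
    (hWpos : ∀ a c, inv a.1 c.2 ≤ w → (a.1 ∩ c.1).card ≠ 1 → 0 ≤ W a c) :
    ∃ (u : {a : Finset (Fin n) // a.card = k} → ℝ) (v : Finset (Fin n) × Equiv.Perm (Fin n) → ℝ),
      (∀ a, 0 ≤ u a) ∧ (∀ c, 0 ≤ v c) ∧ (∀ a c, u a * v c ≤ pencilEntry n lam a.1 c) ∧
      min 1 (lam * (w + 1)) * (∑ a, ∑ c, if inv a.1 c.2 ≤ w ∧ (a.1 ∩ c.1).card ≠ 1 then W a c else 0) ≤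
        2 * q * ∑ a, ∑ c, W a c * (u a * v c) := by
  classical
  have hq : 0 < q := Nat.pos_of_ne_zero (NeZero.ne q)
  refine hash_rectangle_cap (Ξ := (Fin n → ZMod q) × ZMod q) (pencilEntry n lam ∘ Subtype.val) W
    (fun a c => inv a.1 c.2 ≤ (w : ℤ)) (fun a c => (a.1 ∩ c.1).card)
    (fun ξ a => hashOf ξ.1 a.1 = ξ.2) hq hqN (s := min 1 (lam * (w + 1)))
    (le_min zero_le_one (mul_nonneg hlam (by positivity))) ?_ ?_ ?_ ?_ ?_ hWfar hWpos
  · -- M ≥ 0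
    intro a c
    simp only [Function.comp, pencilEntry]
    have h1 := sq_nonneg ((1 : ℝ) - ((a.1 ∩ c.1).card : ℝ))
    have h2 : (0 : ℝ) ≤ (inv a.1 c.2 : ℝ) := by exact_mod_cast inv_nonneg a.1 c.2
    nlinarith [mul_nonneg hlam h2]
  · -- M ≥ s off the near level-1 entries
    intro a c h
    simp only [Function.comp, pencilEntry]
    have h2 : (0 : ℝ) ≤ (inv a.1 c.2 : ℝ) := by exact_mod_cast inv_nonneg a.1 c.2
    by_cases hn : inv a.1 c.2 ≤ (w : ℤ)
    · have hsq := one_le_sq_one_sub_of_ne_one (h hn)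
      have := min_le_left (1 : ℝ) (lam * (w + 1))
      nlinarith [mul_nonneg hlam h2]
    · have hfar : ((w : ℝ) + 1) ≤ (inv a.1 c.2 : ℝ) := by
        have : (w : ℤ) + 1 ≤ inv a.1 c.2 := by omega
        exact_mod_cast this
      have := min_le_right (1 : ℝ) (lam * (w + 1))
      have hsq := sq_nonneg ((1 : ℝ) - ((a.1 ∩ c.1).card : ℝ))
      nlinarith [mul_le_mul_of_nonneg_left hfar hlam]
  · -- one hash constraint
    intro a
    have := hash_count_one (q := q) a.1
    have h' : (Fintype.card ((Fin n → ZMod q) × ZMod q) : ℝ) =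
        q * ((Finset.univ.filter (fun ξ : (Fin n → ZMod q) × ZMod q => hashOf ξ.1 a.1 = ξ.2)).card : ℝ) := by
      exact_mod_cast this.symm
    exact h'.le
  · -- two hash constraints
    intro a a' haa
    have hne : a.1 ≠ a'.1 := fun h => haa (Subtype.ext h)
    have := hash_count_two (q := q) hne
    have h' : (q : ℝ) ^ 2 * ((Finset.univ.filter (fun ξ : (Fin n → ZMod q) × ZMod q =>
        hashOf ξ.1 a.1 = ξ.2 ∧ hashOf ξ.1 a'.1 = ξ.2)).card : ℝ) = Fintype.card ((Fin n → ZMod q) × ZMod q) := by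
      exact_mod_cast this
    exact h'.le
  · -- the located neighbourhood bound (K3)
    intro c
    calc (Finset.univ.filter (fun a : {a : Finset (Fin n) // a.card = k} =>
            inv a.1 c.2 ≤ (w : ℤ) ∧ (a.1 ∩ c.1).card = 1)).card
        ≤ ((Finset.univ : Finset (Finset (Fin n))).filter (fun a => a.card = k ∧ inv a c.2 ≤ w)).card := by
          refine Finset.card_le_card_of_injOn Subtype.val ?_ ?_
          · intro a ha
            rw [Finset.mem_coe, mem_filter] at ha
            rw [Finset.mem_coe, mem_filter]
            exact ⟨mem_univ _, a.2, ha.2.1⟩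
          · intro a _ a' _ h
            exact Subtype.ext h
      _ ≤ ((w + 1) ^ Nat.sqrt w) ^ 2 := card_informative_rows_le c.2 hkn w

/-! ### PROPOSITION H′: EVERY near-supported witness is capped (any sign pattern) — hash × carrier rectangles -/

end HashCap

end Summit.ValiantsHypothesis.Theorems.NNDivisionHardNegative.AsymmetricWindow
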